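import Summits.Schanuel.Schanuel.Theorems.DiophantineDichotomyApproximationPropertyDeficientLeverDefs
import Summits.Schanuel.Schanuel.Theorems.DiophantineDichotomyApproximationPropertySharpClosestPoint
import HarnessLib

/-!
# Stub `sharpClosestPointDeficient_of` of line `orbit-interpolation-determinant` (crux `ApproximationProperty`, stmt-Schanuel-6117)

The deficient-rank `ℓ`-extraction
`OrbitClusterBoundDeficient → ZeroDimDictionaryDeficient → SharpClosestPointDeficient` of the checked
skeleton `Cruxes/ApproximationProperty/Lines/orbit-interpolation-determinant.lean` (vocabulary:
`DiophantineDichotomyApproximationPropertyDeficientLeverDefs.lean`; the full-rank version is the landed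
`stub_sharpClosestPoint`, `DiophantineDichotomyApproximationPropertySharpClosestPoint.lean`, of which
this file is a copy with two local changes): given the deficient lever `OrbitClusterBoundDeficient`
(conjugate clustering costs `(kr/D)^{1+1/m}` for `r` `ℚ`-independent monomials of degree `≤ δ`) and
the dictionary `ZeroDimDictionaryDeficient` (clause (E′): `r = H(𝔭; δ)` independent monomials in the
chart `b₀ ≠ 0`), a homogeneous prime `𝔭 ⊂ ℚ[x₀, …, x_m]` of rank `1` whose zeros impose at least
`deg 𝔭 / K₀` conditions on the forms of degree `δ` (`deg 𝔭 + K₀·dim(ℚ[x]_δ ∩ 𝔭) ≤ K₀·dim ℚ[x]_δ`)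
has a zero `β̄` with
`‖(1:ω) − β̄‖^ℓ ≤ |𝔭(1:ω)| · exp(C δ h(𝔭)/ℓ^{1/m} + C' deg 𝔭 ((δ+1)(log(2+‖ω‖)+1) + log(deg 𝔭+1)))`,
`C = 2 C_lever K₀² m/c₀` independent of `ℓ`, `ℓ ≥ ℓ₀ = K₀ (⌈(2/c₀)^m⌉ + 1)`.

Proof: with `r := dim ℚ[x]_δ − dim(ℚ[x]_δ ∩ 𝔭)` one has `D = deg 𝔭 ≤ K₀ r`, and (E′) supplies `r`
independent monomials; order the conjugates `σ ∘ b` of the dictionary's point by projective distance to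
`ω̄ = (1 : ω)`; the `k` closest ones are affine-near `ω` (`PhilipponMain.affine_near_of_projDist_le`),
so the deficient lever with `κ = kr/D ≥ k/K₀ ≥ max(1, (2/c₀)^m)` bounds
`log (1/ρ_k) ≤ A + K₀² B k^{-1-1/m}` (`sharpDef_log_inv_projDist_le`); the extraction
`sharp_pow_le_prod_mul_exp` and the dictionary's value clause `∏_σ ρ_σ ≤ e^{c deg 𝔭} |𝔭(ω̄)|` give the
claim with the closest conjugate as witness, the bookkeeping being `sharp_exponent_le` with the lever
constant `C K₀²`.

Sources: NesterenkoPhilippon2001 (LNM 1752) Ch. 3 §4 (Prop. 4.13); LaurentRoy1999; the line's memos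
`Cruxes/ApproximationProperty/KERNEL-c6.md` (R1), `KERNEL-c8.md` (§4).
-/

noncomputable section

-- `Summit.Schanuel.Schanuel.…` is the mandated summit/sub-problem namespace (single-conjunct summit), hence:
set_option linter.dupNamespace false

attribute [local instance] MvPolynomial.gradedAlgebra

namespace Summit.Schanuel.Schanuel.Cruxes.ApproximationProperty.OrbitInterpolationDeterminant

open Literature.NumberTheory.Transcendental.Nesterenko MvPolynomial
open Literature.NumberTheory.Transcendental.PhilipponMain
open scoped BigOperators

/-! ### The per-conjugate bound from the deficient lever -/

set_option maxHeartbeats 400000 in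
/-- **The deficient lever, applied to the `i + 1` closest conjugates.** Order the conjugates
`τ 0, τ 1, …` of the point `b` (`D = [K:ℚ] ≤ K₀ r`) by projective distance `ρ` to `ω̄ = (1 : ω)`. If
`i ≥ ℓ ≥ K₀ (⌈(2/c₀)^m⌉ + 1)` and `ρ (τ i) > 0`, then either `ρ (τ i) ≥ 1/(2|ω̄|²)`, or the `i + 1`
closest conjugates are affine points in the polydisc of radius `rad = 2|ω̄|² ρ(τ i) ≤ 1` about `ω`
(`affine_near_of_projDist_le`), in particular `b₀ ≠ 0` and (E′) gives `r` independent monomials of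
degree `≤ δ` in `bⱼ/b₀`, and the deficient orbit-cluster bound with `k = i + 1` distinct embeddings
(`κ = kr/D ≥ k/K₀ ≥ max (1, (2/c₀)^m)`, so `c₀ κ^{1+1/m} − κ ≥ (c₀/2) κ^{1+1/m}` and
`κ^{-1-1/m} ≤ K₀² k^{-1-1/m}`) gives
`log (1/ρ(τ i)) ≤ log (2|ω̄|²) + (2CK₀²/c₀)(δ log(2+‖ω‖) + log(δ+2)) + (2CK₀²/c₀)(δ (h + c D) + D log(D+1)) (i+1)^{-1-1/m}`.
[folklore] -/
theorem sharpDef_log_inv_projDist_le {m : ℕ} (hm : 1 ≤ m) {c₀ C cd : ℝ} (hc₀ : 0 < c₀) (hC : 0 < C)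
    {K₀ : ℕ} (hK₀ : 1 ≤ K₀) {K : Type} [Field K] [NumberField K]
    (hocb : ∀ (β : Fin m → K) (δ k r : ℕ) (α : Fin r → Fin m → ℕ) (σ : Fin k → (K →+* ℂ))
      (x : Fin m → ℂ) (rad : ℝ), 1 ≤ r → (∀ j, ∑ l, α j l ≤ δ) →
      LinearIndependent ℚ (fun j => ∏ l, β l ^ α j l) → Function.Injective σ → 0 < rad →
      rad ≤ 1 → (∀ i, ‖(fun j => σ i (β j)) - x‖ ≤ rad) →
      (c₀ * ((k : ℝ) * r / Module.finrank ℚ K) ^ (1 + 1 / (m : ℝ)) -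
          (k : ℝ) * r / Module.finrank ℚ K) * Real.log (1 / rad) ≤
        C * (δ * ((r : ℝ) / Module.finrank ℚ K) *
              Height.logHeight (Fin.cons (1 : K) β : Fin (m + 1) → K) +
            r * Real.log (Module.finrank ℚ K + 1) +
            (k : ℝ) * r / Module.finrank ℚ K * δ * Real.log (2 + ‖x‖) +
            (k : ℝ) * r / Module.finrank ℚ K * Real.log ((δ : ℝ) + 2)))
    {b : Fin (m + 1) → K} (hb0 : b ≠ 0) {δ r : ℕ} (hr1 : 1 ≤ r)
    (hE : b 0 ≠ 0 → ∃ α : Fin r → Fin m → ℕ, (∀ j, ∑ l, α j l ≤ δ) ∧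
      LinearIndependent ℚ (fun j => ∏ l, (b l.succ / b 0) ^ α j l))
    {D : ℕ} (hB : Module.finrank ℚ K = D) (hrD : D ≤ K₀ * r) {hgt : ℝ}
    (hCht : Height.logHeight b ≤ hgt + cd * D)
    (ω : Fin m → ℂ) {τ : Fin D → (K →+* ℂ)} (hτ : Function.Injective τ)
    (hmono : Monotone fun i => projDist (Fin.cons 1 ω) (fun j => τ i (b j)))
    {ℓ : ℕ} (hℓ : K₀ * (⌈(2 / c₀) ^ m⌉₊ + 1) ≤ ℓ) (i : Fin D) (hi : ℓ ≤ (i : ℕ))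
    (hpos : 0 < projDist (Fin.cons 1 ω) (fun j => τ i (b j))) :
    Real.log (1 / projDist (Fin.cons 1 ω) (fun j => τ i (b j))) ≤
      Real.log (2 * ‖(Fin.cons 1 ω : Fin (m + 1) → ℂ)‖ ^ 2) +
          2 * (C * (K₀ : ℝ) ^ 2) / c₀ * (δ * Real.log (2 + ‖ω‖) + Real.log ((δ : ℝ) + 2)) +
        2 * (C * (K₀ : ℝ) ^ 2) / c₀ * (δ * (hgt + cd * D) + D * Real.log ((D : ℝ) + 1)) *
          ((i : ℝ) + 1) ^ (-(1 + 1 / (m : ℝ))) := by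
  have hm0 : (0 : ℝ) < m := by exact_mod_cast hm
  have hK₀r : (1 : ℝ) ≤ K₀ := by exact_mod_cast hK₀
  have hK₀pos : (0 : ℝ) < K₀ := by linarith
  set ωb : Fin (m + 1) → ℂ := Fin.cons 1 ω with hωb
  set Θ : ℝ := ‖ωb‖ with hΘ
  have hΘ1 : 1 ≤ Θ := one_le_norm_cons_one ω
  set L : ℝ := Real.log (2 + ‖ω‖) with hL
  set LD : ℝ := Real.log ((D : ℝ) + 1) with hLD
  set kap : ℝ := 2 * C / c₀ with hkap
  have hL0 : 0 < L := (Real.log_pos one_lt_two).trans_le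
    (Real.log_le_log two_pos (by linarith [norm_nonneg ω]))
  have hD1 : (1 : ℝ) ≤ D := by
    have : 0 < D := by rw [← hB]; exact Module.finrank_pos
    exact_mod_cast this
  have hD0 : (0 : ℝ) < D := by linarith
  have hLD0 : 0 ≤ LD := Real.log_nonneg (by linarith)
  have hkap0 : 0 < kap := by positivity
  have hlogδ : 0 ≤ Real.log ((δ : ℝ) + 2) :=
    Real.log_nonneg (by linarith [(Nat.cast_nonneg δ : (0 : ℝ) ≤ δ)])
  have hhgt : 0 ≤ hgt + cd * D := (Height.logHeight_nonneg b).trans hCht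
  have hK₀2 : (1 : ℝ) ≤ (K₀ : ℝ) ^ 2 := one_le_pow₀ hK₀r
  set ρ : (K →+* ℂ) → ℝ := fun σ => projDist ωb (fun j => σ (b j)) with hρ
  have hρ0 : ∀ σ, 0 ≤ ρ σ := fun σ => projDist_nonneg _ _
  set ρi : ℝ := ρ (τ i) with hρi
  -- `k = i + 1`
  set k : ℕ := (i : ℕ) + 1 with hk
  have hkD : k ≤ D := i.2
  have hkr : (k : ℝ) = (i : ℝ) + 1 := by rw [hk]; push_cast; ring
  have hkpos : (0 : ℝ) < k := by rw [hkr]; positivity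
  have hPdef : ((i : ℝ) + 1) ^ (-(1 + 1 / (m : ℝ))) = ((k : ℝ) ^ (1 + 1 / (m : ℝ)))⁻¹ := by
    rw [← hkr, Real.rpow_neg hkpos.le]
  have hBi0 : 0 ≤ 2 * (C * (K₀ : ℝ) ^ 2) / c₀ * (δ * (hgt + cd * D) + D * LD) *
      ((i : ℝ) + 1) ^ (-(1 + 1 / (m : ℝ))) :=
    mul_nonneg (by positivity) (Real.rpow_nonneg (by positivity) _)
  have hAi0 : 0 ≤ 2 * (C * (K₀ : ℝ) ^ 2) / c₀ * (δ * L + Real.log ((δ : ℝ) + 2)) := by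
    positivity
  by_cases hsmall : ρi * (2 * Θ ^ 2) ≤ 1
  swap
  · -- a far conjugate costs `log (2Θ²)` only
    have hlt : 1 < ρi * (2 * Θ ^ 2) := lt_of_not_ge hsmall
    have : Real.log (1 / ρi) ≤ Real.log (2 * Θ ^ 2) := by
      refine Real.log_le_log (by positivity) ?_
      rw [div_le_iff₀ hpos]; linarith
    linarith
  -- a near conjugate: the `k = i + 1` closest conjugates are affine points near `ω`
  set rad : ℝ := 2 * Θ ^ 2 * ρi with hrad
  have hrad0 : 0 < rad := by positivity
  have hrad1 : rad ≤ 1 := by rw [hrad]; linarith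
  set σ' : Fin k → (K →+* ℂ) := fun j => τ (Fin.castLE hkD j) with hσ'
  have hσ'inj : Function.Injective σ' := hτ.comp (Fin.castLE_injective hkD)
  have hσ'le : ∀ j : Fin k, ρ (σ' j) ≤ ρi := fun j => by
    have hji : Fin.castLE hkD j ≤ i := by
      rw [Fin.le_def, Fin.val_castLE]; omega
    exact hmono hji
  have hnear' : ∀ j : Fin k, σ' j (b 0) ≠ 0 ∧
      ∀ j' : Fin m, ‖σ' j (b j'.succ) / σ' j (b 0) - ω j'‖ ≤ rad := by
    intro j
    have hd : projDist ωb (fun j' => σ' j (b j')) * ‖ωb‖ ≤ 1 / 2 := by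
      have h1 : projDist ωb (fun j' => σ' j (b j')) ≤ ρi := hσ'le j
      have h2 : ρi * Θ ≤ 1 / 2 := by
        have : ρi * Θ ≤ ρi * Θ * Θ := le_mul_of_one_le_right (by positivity) hΘ1
        linarith
      calc _ ≤ ρi * Θ := mul_le_mul_of_nonneg_right h1 (by positivity)
        _ ≤ 1 / 2 := h2
    obtain ⟨h0, -, hz⟩ := affine_near_of_projDist_le ω (sharp_conj_ne_zero (σ' j) hb0) hd
    refine ⟨h0, fun j' => (hz j').trans ?_⟩
    exact mul_le_mul_of_nonneg_left (hσ'le j) (by positivity)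
  have hb00 : b 0 ≠ 0 := by
    intro h
    exact (hnear' ⟨0, by omega⟩).1 (by rw [h, map_zero])
  set b' : Fin m → K := fun j' => b j'.succ / b 0 with hb'
  have hnear : ∀ j : Fin k, ‖(fun j' => σ' j (b' j')) - ω‖ ≤ rad := by
    intro j
    refine (pi_norm_le_iff_of_nonneg hrad0.le).mpr fun j' => ?_
    simp only [Pi.sub_apply, hb', map_div₀]
    exact (hnear' j).2 j'
  -- the independent monomials of clause (E′) and the deficient lever
  obtain ⟨α, hαδ, hαli⟩ := hE hb00
  have hrD' : (r : ℝ) ≤ D := by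
    have := hαli.fintype_card_le_finrank
    rw [Fintype.card_fin, hB] at this
    exact_mod_cast this
  have hrDr : (D : ℝ) ≤ K₀ * r := by exact_mod_cast hrD
  have hlev := hocb b' δ k r α σ' ω rad hr1 hαδ hαli hσ'inj hrad0 hrad1 hnear
  have hheight : Height.logHeight (Fin.cons (1 : K) b' : Fin (m + 1) → K) =
      Height.logHeight b := by
    have e : (Fin.cons (1 : K) b' : Fin (m + 1) → K) = (b 0)⁻¹ • b := by
      funext j
      refine Fin.cases ?_ (fun j' => ?_) j
      · simp [hb00]
      · simp [hb', div_eq_inv_mul]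
    rw [e, Height.logHeight_smul_eq_logHeight b (inv_ne_zero hb00)]
  rw [hheight, hB] at hlev
  -- `q = k r / D ≥ k / K₀ ≥ max (1, (2/c₀)^m)`, `P = q^{1+1/m}`
  set q : ℝ := (k : ℝ) * r / D with hq
  have hqk : (k : ℝ) / K₀ ≤ q := by
    rw [hq, div_le_div_iff₀ hK₀pos hD0]
    have := mul_le_mul_of_nonneg_left hrDr hkpos.le
    linarith
  have hkK₀N : K₀ * (⌈(2 / c₀) ^ m⌉₊ + 1) + 1 ≤ k := by omega
  have hkK₀ : (K₀ : ℝ) * ((⌈(2 / c₀) ^ m⌉₊ : ℝ) + 1) + 1 ≤ k := by exact_mod_cast hkK₀N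
  have hq_ge : ((⌈(2 / c₀) ^ m⌉₊ : ℝ) + 1) ≤ q := by
    refine le_trans ?_ hqk
    rw [le_div_iff₀ hK₀pos]
    linarith
  have hq1 : 1 ≤ q := by linarith [(Nat.cast_nonneg _ : (0 : ℝ) ≤ ⌈(2 / c₀) ^ m⌉₊)]
  have hq0 : 0 < q := by linarith
  have hqm : (2 / c₀) ^ m ≤ q := (Nat.le_ceil _).trans (by linarith)
  set P : ℝ := q ^ (1 + 1 / (m : ℝ)) with hP
  have hP0 : 0 < P := Real.rpow_pos_of_pos hq0 _
  have hqP : q ≤ P := by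
    rw [hP, Real.rpow_add hq0, Real.rpow_one]
    exact le_mul_of_one_le_right hq0.le (Real.one_le_rpow hq1 (by positivity))
  have hPinv : P⁻¹ ≤ (K₀ : ℝ) ^ 2 * ((i : ℝ) + 1) ^ (-(1 + 1 / (m : ℝ))) := by
    rw [hPdef]
    have h1 : ((k : ℝ) / K₀) ^ (1 + 1 / (m : ℝ)) ≤ P :=
      Real.rpow_le_rpow (by positivity) hqk (by positivity)
    rw [Real.div_rpow hkpos.le hK₀pos.le] at h1
    have hK₀e : (K₀ : ℝ) ^ (1 + 1 / (m : ℝ)) ≤ (K₀ : ℝ) ^ 2 := by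
      rw [← Real.rpow_two]
      refine Real.rpow_le_rpow_of_exponent_le hK₀r ?_
      have : 1 / (m : ℝ) ≤ 1 := by rw [div_le_one hm0]; exact_mod_cast hm
      linarith
    have hke : 0 < (k : ℝ) ^ (1 + 1 / (m : ℝ)) := Real.rpow_pos_of_pos hkpos _
    have hK₀e0 : 0 < (K₀ : ℝ) ^ (1 + 1 / (m : ℝ)) := Real.rpow_pos_of_pos hK₀pos _
    calc P⁻¹ ≤ ((k : ℝ) ^ (1 + 1 / (m : ℝ)) / (K₀ : ℝ) ^ (1 + 1 / (m : ℝ)))⁻¹ :=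
          inv_anti₀ (by positivity) h1
      _ = (K₀ : ℝ) ^ (1 + 1 / (m : ℝ)) * ((k : ℝ) ^ (1 + 1 / (m : ℝ)))⁻¹ := by
          rw [inv_div, div_eq_mul_inv]
      _ ≤ (K₀ : ℝ) ^ 2 * ((k : ℝ) ^ (1 + 1 / (m : ℝ)))⁻¹ :=
          mul_le_mul_of_nonneg_right hK₀e (inv_nonneg.mpr hke.le)
  -- the coefficient: `c₀ q^{1+1/m} − q ≥ (c₀/2) q^{1+1/m}` since `q ≥ (2/c₀)^m`
  have hcoef : c₀ / 2 * P ≤ c₀ * P - q := by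
    have hkm : 2 / c₀ ≤ q ^ (1 / (m : ℝ)) := by
      have := Real.rpow_le_rpow (by positivity) hqm (show (0 : ℝ) ≤ 1 / (m : ℝ) by positivity)
      rwa [show ((2 / c₀) ^ m) ^ (1 / (m : ℝ)) = 2 / c₀ from by
        rw [one_div]; exact Real.pow_rpow_inv_natCast (by positivity) (by omega)] at this
    have h3 : 1 ≤ c₀ / 2 * q ^ (1 / (m : ℝ)) := by
      have := mul_le_mul_of_nonneg_left hkm (show 0 ≤ c₀ / 2 by positivity)
      rwa [show c₀ / 2 * (2 / c₀) = 1 by field_simp] at this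
    have h4 : q ≤ c₀ / 2 * P := by
      rw [hP, Real.rpow_add hq0, Real.rpow_one]
      calc q = q * 1 := (mul_one _).symm
        _ ≤ q * (c₀ / 2 * q ^ (1 / (m : ℝ))) := mul_le_mul_of_nonneg_left h3 hq0.le
        _ = _ := by ring
    linarith
  have hlog_r : 0 ≤ Real.log (1 / rad) :=
    Real.log_nonneg (by rw [le_div_iff₀ hrad0]; linarith)
  have hmain : c₀ / 2 * P * Real.log (1 / rad) ≤
      C * (δ * ((r : ℝ) / D) * Height.logHeight b + r * LD + q * δ * L +
        q * Real.log ((δ : ℝ) + 2)) :=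
    (mul_le_mul_of_nonneg_right hcoef hlog_r).trans hlev
  have hT : C * (δ * ((r : ℝ) / D) * Height.logHeight b + r * LD + q * δ * L +
        q * Real.log ((δ : ℝ) + 2)) ≤
      c₀ / 2 * P * (kap * (δ * L + Real.log ((δ : ℝ) + 2)) +
        kap * (δ * (hgt + cd * D) + D * LD) * P⁻¹) := by
    have e : c₀ / 2 * P * (kap * (δ * L + Real.log ((δ : ℝ) + 2)) +
        kap * (δ * (hgt + cd * D) + D * LD) * P⁻¹)
        = C * P * (δ * L + Real.log ((δ : ℝ) + 2)) + C * (δ * (hgt + cd * D) + D * LD) := by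
      rw [hkap]; field_simp
    rw [e]
    have hAL : 0 ≤ δ * L + Real.log ((δ : ℝ) + 2) := by positivity
    have h1 := mul_le_mul_of_nonneg_left (mul_le_mul_of_nonneg_right hqP hAL) hC.le
    have h2 := mul_le_mul_of_nonneg_left (mul_le_mul_of_nonneg_left hCht (Nat.cast_nonneg δ))
      hC.le
    have hrD1 : (r : ℝ) / D ≤ 1 := (div_le_one hD0).mpr hrD'
    have hH0 : 0 ≤ (δ : ℝ) * Height.logHeight b :=
      mul_nonneg (Nat.cast_nonneg δ) (Height.logHeight_nonneg b)
    have h3 : (δ : ℝ) * ((r : ℝ) / D) * Height.logHeight b ≤ δ * Height.logHeight b := by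
      calc (δ : ℝ) * ((r : ℝ) / D) * Height.logHeight b
          = (r : ℝ) / D * (δ * Height.logHeight b) := by ring
        _ ≤ 1 * (δ * Height.logHeight b) := mul_le_mul_of_nonneg_right hrD1 hH0
        _ = δ * Height.logHeight b := one_mul _
    have h4 : (r : ℝ) * LD ≤ D * LD := mul_le_mul_of_nonneg_right hrD' hLD0
    have h5 := mul_le_mul_of_nonneg_left (add_le_add h3 h4) hC.le
    linarith [h1, h2, h5]
  have hlr : Real.log (1 / rad) ≤ kap * (δ * L + Real.log ((δ : ℝ) + 2)) +
      kap * (δ * (hgt + cd * D) + D * LD) * P⁻¹ :=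
    le_of_mul_le_mul_left (hmain.trans hT) (by positivity)
  have hsplit : Real.log (1 / ρi) = Real.log (2 * Θ ^ 2) + Real.log (1 / rad) := by
    rw [← Real.log_mul (by positivity) (by positivity)]
    congr 1
    rw [hrad]; field_simp
  -- weaken by `K₀² ≥ 1` and `P⁻¹ ≤ K₀² (i+1)^{-1-1/m}`
  have hS1 : 0 ≤ kap * (δ * L + Real.log ((δ : ℝ) + 2)) := by positivity
  have hS2 : 0 ≤ kap * (δ * (hgt + cd * D) + D * LD) := by positivity
  have hw1 : kap * (δ * L + Real.log ((δ : ℝ) + 2)) ≤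
      kap * (δ * L + Real.log ((δ : ℝ) + 2)) * (K₀ : ℝ) ^ 2 :=
    le_mul_of_one_le_right hS1 hK₀2
  have hw2 : kap * (δ * (hgt + cd * D) + D * LD) * P⁻¹ ≤
      kap * (δ * (hgt + cd * D) + D * LD) *
        ((K₀ : ℝ) ^ 2 * ((i : ℝ) + 1) ^ (-(1 + 1 / (m : ℝ)))) :=
    mul_le_mul_of_nonneg_left hPinv hS2
  have hkap2 : 2 * (C * (K₀ : ℝ) ^ 2) / c₀ = kap * (K₀ : ℝ) ^ 2 := by rw [hkap]; ring
  rw [hsplit, hkap2]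
  linarith [hlr, hw1, hw2]

/-! ### The stub -/

/-- **Registered stub `sharpClosestPointDeficient_of` of line `orbit-interpolation-determinant`** — the
deficient-rank `ℓ`-extraction
`OrbitClusterBoundDeficient → ZeroDimDictionaryDeficient → SharpClosestPointDeficient`: the deficient
lever (conjugate clustering costs `(kr/D)^{1+1/m}` for `r` independent monomials) and the 0-dimensional
dictionary with clause (E′) give the sharp closest-point property under the near-clause
`deg 𝔭 + K₀·dim(ℚ[x]_δ ∩ 𝔭) ≤ K₀·dim ℚ[x]_δ`, with the `ℓ`-independent constant
`C = 2 C_lever K₀² m / c₀`, `ℓ₀ = K₀ (⌈(2/c₀)^m⌉ + 1)` and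
`C'(ℓ) = ℓ log 2 + c + 3 + (2 C_lever K₀²/c₀)(1 + m c + m)`. [folklore] -/
theorem sharpClosestPointDeficient_of :
    OrbitClusterBoundDeficient → ZeroDimDictionaryDeficient → SharpClosestPointDeficient := by
  intro hOCB hZDD m hm K₀ hK₀
  obtain ⟨c₀, hc₀, C, hC, hocb⟩ := hOCB m hm
  obtain ⟨cd, hcd, hdict⟩ := hZDD m hm
  have hlog2 : 0 < Real.log 2 := Real.log_pos one_lt_two
  have hm0 : (0 : ℝ) < m := by exact_mod_cast hm
  have hK₀r : (1 : ℝ) ≤ K₀ := by exact_mod_cast hK₀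
  set C₁ : ℝ := C * (K₀ : ℝ) ^ 2 with hC₁def
  have hC₁ : 0 < C₁ := by positivity
  refine ⟨2 * C₁ * m / c₀, by positivity, K₀ * (⌈(2 / c₀) ^ m⌉₊ + 1), fun ℓ hℓ => ?_⟩
  refine ⟨ℓ * Real.log 2 + cd + 3 + 2 * C₁ / c₀ * (1 + m * cd + m), by positivity, ?_⟩
  intro 𝔭 δ ω h𝔭 hhom hunm hclause
  obtain ⟨K, _i1, _i2, b, hb0, hA, -, hB, hCht, hDval, -, hE'⟩ := hdict 𝔭 h𝔭 hhom hunm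
  generalize hDdef : ideg 𝔭 1 = D at *
  -- basic quantities
  have hℓ1 : 1 ≤ ℓ := le_trans (hK₀.trans (Nat.le_mul_of_pos_right K₀ (Nat.succ_pos _))) hℓ
  have hD0 : 0 < D := by rw [← hB]; exact Module.finrank_pos
  have hD1r : (1 : ℝ) ≤ D := by exact_mod_cast hD0
  have hcard : Fintype.card (K →+* ℂ) = D := by rw [NumberField.Embeddings.card, hB]
  -- the rank `r = H(𝔭; δ)` of the near-clause: `r + dim(ℚ[x]_δ ∩ 𝔭) ≤ dim ℚ[x]_δ`, `D ≤ K₀ r`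
  set N : ℕ := Module.finrank ℚ ↥(homogeneousSubmodule (Fin (m + 1)) ℚ δ) with hN
  set M : ℕ := Module.finrank ℚ ↥(homogeneousSubmodule (Fin (m + 1)) ℚ δ ⊓ 𝔭.restrictScalars ℚ)
    with hM
  have hMN : M ≤ N := by
    haveI : Module.Finite ℚ ↥(homogeneousSubmodule (Fin (m + 1)) ℚ δ) :=
      Module.Finite.iff_fg.mpr (homogeneousSubmodule_fg _ _ _)
    exact Submodule.finrank_mono inf_le_left
  obtain ⟨r, hrN, hrD⟩ : ∃ r : ℕ, r + M ≤ N ∧ D ≤ K₀ * r :=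
    ⟨N - M, by omega, by rw [Nat.mul_sub]; omega⟩
  have hr1 : 1 ≤ r := by
    rcases Nat.eq_zero_or_pos r with h | h
    · rw [h, mul_zero] at hrD; omega
    · exact h
  set ωb : Fin (m + 1) → ℂ := Fin.cons 1 ω with hωb
  set Θ : ℝ := ‖ωb‖ with hΘ
  have hΘ1 : 1 ≤ Θ := one_le_norm_cons_one ω
  have hΘle : Θ ≤ 2 + ‖ω‖ := sharp_norm_cons_one_le ω
  set L : ℝ := Real.log (2 + ‖ω‖) with hL
  set hgt : ℝ := iheight 𝔭 1 with hhgt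
  set LD : ℝ := Real.log ((D : ℝ) + 1) with hLD
  have hhgt0 : 0 ≤ hgt := height_nonneg _
  have hL2 : Real.log 2 ≤ L := Real.log_le_log two_pos (by linarith [norm_nonneg ω])
  have hL0 : 0 < L := hlog2.trans_le hL2
  have hLD0 : 0 ≤ LD := Real.log_nonneg (by linarith)
  have hlogΘ2 : 0 ≤ Real.log (2 * Θ ^ 2) := Real.log_nonneg (by nlinarith)
  have hlogδ : 0 ≤ Real.log ((δ : ℝ) + 2) :=
    Real.log_nonneg (by linarith [(Nat.cast_nonneg δ : (0 : ℝ) ≤ δ)])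
  -- the projective distances of the conjugates, sorted increasingly
  set ρ : (K →+* ℂ) → ℝ := fun σ => projDist ωb (fun j => σ (b j)) with hρ
  have hρ0 : ∀ σ, 0 ≤ ρ σ := fun σ => projDist_nonneg _ _
  have hρ2 : ∀ σ, ρ σ ≤ 2 := fun σ =>
    Literature.NumberTheory.Transcendental.NguyenRoy.projDist_le_two _ _
  set e₀ : (K →+* ℂ) ≃ Fin D := Fintype.equivFinOfCardEq hcard
  set τ : Fin D ≃ (K →+* ℂ) := (Tuple.sort (ρ ∘ e₀.symm)).trans e₀.symm with hτ
  have hmono : Monotone (ρ ∘ τ) := Tuple.monotone_sort (ρ ∘ e₀.symm)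
  -- the witness: the closest conjugate
  refine ⟨fun j => τ ⟨0, hD0⟩ (b j), ?_, ?_⟩
  · rw [hA]
    exact ⟨sharp_conj_ne_zero _ hb0, τ ⟨0, hD0⟩, 1, by simp⟩
  -- constants of the per-conjugate bound
  set A : ℝ := Real.log (2 * Θ ^ 2) + 2 * C₁ / c₀ * (δ * L + Real.log ((δ : ℝ) + 2)) with hAdef
  set B : ℝ := 2 * C₁ / c₀ * (δ * (hgt + cd * D) + D * LD) with hBdef
  have hA0 : 0 ≤ A := by positivity
  have hB0 : 0 ≤ B := by positivity
  have hbound : ∀ i : Fin D, ℓ ≤ (i : ℕ) → 0 < (ρ ∘ τ) i →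
      Real.log (1 / (ρ ∘ τ) i) ≤ A + B * ((i : ℝ) + 1) ^ (-(1 + 1 / (m : ℝ))) :=
    fun i hi hpos => sharpDef_log_inv_projDist_le hm hc₀ hC hK₀ (hocb K) hb0 hr1
      (fun h0 => hE' h0 δ r hrN) hB hrD hCht ω τ.injective hmono hℓ i hi hpos
  -- extraction
  have hext := sharp_pow_le_prod_mul_exp hm hℓ1 hD0 (ρ ∘ τ) hmono (fun i => hρ0 _) (fun i => hρ2 _)
    hA0 hB0 hbound
  set X : ℝ := ℓ * Real.log 2 + D * A + B * (m / (ℓ : ℝ) ^ (1 / (m : ℝ))) with hX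
  have hprodτ : ∏ i, (ρ ∘ τ) i = ∏ σ, ρ σ := Equiv.prod_comp τ ρ
  -- the dictionary's value clause
  have hval := hDval ωb (cons_one_ne_zero ω)
  have hprod_le : ∏ σ, ρ σ ≤ Real.exp (cd * D) * iabs 𝔭 1 ωb := by
    have := mul_le_mul_of_nonneg_left hval (Real.exp_nonneg (cd * D))
    rwa [← mul_assoc, ← Real.exp_add, add_neg_cancel, Real.exp_zero, one_mul] at this
  -- the final exponent
  have hfin : cd * D + X ≤ 2 * C₁ * m / c₀ * δ * hgt / (ℓ : ℝ) ^ (1 / (m : ℝ)) +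
      (ℓ * Real.log 2 + cd + 3 + 2 * C₁ / c₀ * (1 + m * cd + m)) * D *
        ((δ + 1) * (L + 1) + LD) := by
    rw [hX, hAdef, hBdef]
    have hν : (1 : ℝ) ≤ (ℓ : ℝ) ^ (1 / (m : ℝ)) :=
      Real.one_le_rpow (by exact_mod_cast hℓ1) (by positivity)
    have hlogΘ : Real.log Θ ≤ L := Real.log_le_log (by linarith) hΘle
    have key := sharp_exponent_le (h := hgt) hC₁ hc₀ hcd (show (1 : ℝ) ≤ m by exact_mod_cast hm)
      (Nat.cast_nonneg δ) hD1r hL2 hΘ1 hlogΘ (show (1 : ℝ) ≤ ℓ by exact_mod_cast hℓ1)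
      hν hLD0
    linarith [key]
  calc projDist ωb (fun j => τ ⟨0, hD0⟩ (b j)) ^ ℓ
      ≤ (∏ i, (ρ ∘ τ) i) * Real.exp X := hext
    _ = (∏ σ, ρ σ) * Real.exp X := by rw [hprodτ]
    _ ≤ Real.exp (cd * D) * iabs 𝔭 1 ωb * Real.exp X :=
        mul_le_mul_of_nonneg_right hprod_le (Real.exp_nonneg _)
    _ = iabs 𝔭 1 ωb * Real.exp (cd * D + X) := by rw [Real.exp_add (cd * D) X]; ring
    _ ≤ _ := mul_le_mul_of_nonneg_left (Real.exp_le_exp.mpr hfin) (iabs_nonneg _ _ _)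

end Summit.Schanuel.Schanuel.Cruxes.ApproximationProperty.OrbitInterpolationDeterminant

end
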